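import Summits.RiemannHypothesis.RiemannHypothesis.Theses.WeilComb
import Summits.RiemannHypothesis.RiemannHypothesis.Theorems.WeilCombCombShapePositivityFejerOfCrux
import Summits.RiemannHypothesis.RiemannHypothesis.Theorems.WeilCombCombShapePositivityStubFejerConvSquare
import Summits.RiemannHypothesis.RiemannHypothesis.Theorems.WeilCombCombShapePositivityStubReduction
import Summits.RiemannHypothesis.RiemannHypothesis.Theorems.WeilCombCombShapePositivityStubGram
import Summits.RiemannHypothesis.RiemannHypothesis.Theorems.WeilCombCombShapePositivityEffectiveWindow
import Summits.RiemannHypothesis.RiemannHypothesis.Theorems.WeilCombCombShapeDetection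
import Literature.NumberTheory.LFunctions.WeilCriterionConverse
import Literature.NumberTheory.LFunctions.LandauOscillation
import Literature.NumberTheory.LFunctions.WeilDilationVirial
import Mathlib

/-!
# STUB-PLAN companion — `stub_fejer` of line `Sketch` (crux `WeilComb.CombShapePositivity`,
stmt-RiemannHypothesis-11229): the MERGED helper-lemma list, Lean-typed (stub-critic)

Companion of `STUB-PLAN-stub_fejer.md` (same directory). Statements only (`sorry`) except the
bookkeeping theorems marked PROVED. Merges `StubFejerIdeas1.lean` (k1: dilation detection),
`StubFejerIdeas2.lean` (k2: zero-side product formula, two primes, regimes, Bochner) and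
`StubFejerK3Sketch.lean` (k3: fixed-`ε` two-prime collapse, window face, heredity).

STANDING FACT. The stub's verbatim signature is the named conjecture
`Theorems.FejerDivisorPositivity` (`Theorems/FejerDivisorPositivity.lean`, landed; here the local stand-in
`StubFejer`, same text) and is kernel-equivalent to `RiemannHypothesis`
(`Theorems.fejerDivisorPositivity_iff_riemannHypothesis` = `WeilCombFejerConvSquare.fejer_iff_riemannHypothesis`). Nothing below claims the
stub. Tiers: T0 retype (lead) · T1 symbol = zero-side series · T2 DILATION DETECTION (minimal face
`S = ∅`) · T3 two-prime collapse at fixed `ε` · T4 zero-side product formula · T5 census corollaries.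
Theorems whose name starts with `stub_` are the ones to REGISTER (`ledger workitem stub-add`) so that the
file proving them lands `--supports stmt-RiemannHypothesis-11229`; their signatures are inline (no local
definitions), exactly as they must be registered.

Notation (local abbreviations, definitionally the stub's sub-terms): `bump ε` = `φ_ε`,
`sym ε x = W(τ_x (φ_ε ⋆ φ̃_ε))`, `diag ε = Q(φ_ε) = W(φ_ε ⋆ φ̃_ε) = sym ε 0`, `chi`, `face`,
`ψ₀ = φ₀ ⋆ φ₀ = bumpK`, `T_w(s) = cauchyT ε₀ w s = ∫_{-2}^{2} ψ₀(t) e^{ε₀(wt − s)}/(s − wt) dt`.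
-/

noncomputable section

set_option linter.dupNamespace false

open scoped BigOperators ComplexConjugate Real Topology
open Complex MeasureTheory Set Filter

namespace Summit.RiemannHypothesis.RiemannHypothesis.Cruxes.CombShapePositivity.StubPlanFejer

open Literature.NumberTheory.LFunctions
open Literature.NumberTheory.LFunctions.WeilConverse
open Summit.RiemannHypothesis.RiemannHypothesis.Theses.WeilComb

/-! ## Notation -/

/-- `φ_ε(t) = ε⁻¹ φ₀(t/ε)`, `φ₀(u) = expNegInvGlue (1 - u²)`. -/
def bump (ε : ℝ) : ℝ → ℂ := fun t : ℝ => (ε : ℂ)⁻¹ * ((expNegInvGlue (1 - (t / ε) ^ 2) : ℝ) : ℂ)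

/-- comb symbol `w_ε(x) = W(τ_x (φ_ε ⋆ φ̃_ε))`. -/
def sym (ε x : ℝ) : ℂ := weilFunctional (weilTranslate (weilConv (bump ε) (weilReflect (bump ε))) x)

/-- the diagonal entry `w_ε(0) = Q(φ_ε)` (the `S = ∅` / `n = 0` face of the stub). -/
def diag (ε : ℝ) : ℂ := weilQuadratic (bump ε)

/-- Bohr character. -/
def chi (S : Finset ℕ) (θ : ℕ → ℝ) (d : ℕ) : ℂ :=
  Complex.exp (I * ((∑ p ∈ S, θ p * (d.factorization p : ℝ) : ℝ) : ℂ))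

/-- the Fejér face = the real number the stub asserts is `≥ 0`. -/
def face (ε : ℝ) (S : Finset ℕ) (n : ℕ) (θ : ℕ → ℝ) : ℝ :=
  (∑ d ∈ (∏ p ∈ S, p ^ n).divisors, ∑ d' ∈ (∏ p ∈ S, p ^ n).divisors,
    chi S θ d * conj (chi S θ d') * sym ε (Real.log (d : ℝ) - Real.log (d' : ℝ))).re

/-- faithfulness: `face` is the stub's left-hand side (`rfl`). PROVED. -/
theorem face_eq_verbatim (ε : ℝ) (S : Finset ℕ) (n : ℕ) (θ : ℕ → ℝ) :
    face ε S n θ =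
      (∑ d ∈ (∏ p ∈ S, p ^ n).divisors, ∑ d' ∈ (∏ p ∈ S, p ^ n).divisors,
        Complex.exp (I * ((∑ p ∈ S, θ p * (d.factorization p : ℝ) : ℝ) : ℂ)) *
          conj (Complex.exp (I * ((∑ p ∈ S, θ p * (d'.factorization p : ℝ) : ℝ) : ℂ))) *
          weilFunctional (weilTranslate
            (weilConv (fun t : ℝ => (ε : ℂ)⁻¹ * ((expNegInvGlue (1 - (t / ε) ^ 2) : ℝ) : ℂ))
              (weilReflect (fun t : ℝ => (ε : ℂ)⁻¹ * ((expNegInvGlue (1 - (t / ε) ^ 2) : ℝ) : ℂ))))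
            (Real.log (d : ℝ) - Real.log (d' : ℝ)))).re := rfl

/-- `diag ε = sym ε 0`. PROVED. -/
theorem diag_eq_sym_zero (ε : ℝ) : diag ε = sym ε 0 := by
  unfold diag sym weilQuadratic
  congr 1
  funext t
  simp [weilTranslate]

/-! ## T0 — RETYPE (lead, skeleton v8): the stub IS the named conjecture; composition unchanged -/

/-- Local stand-in for the tree's `Summit.RiemannHypothesis.RiemannHypothesis.Theorems.FejerDivisorPositivity`
(`Theorems/FejerDivisorPositivity.lean`, landed; SAME TEXT — that module was still unbuilt on the farm when this
file was checked, so it is not imported here): the registered signature of `stub_fejer`, verbatim. -/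
def StubFejer : Prop :=
  ∀ ε : ℝ, 0 < ε → ∀ S : Finset ℕ, (∀ p ∈ S, p.Prime) → ∀ (n : ℕ) (θ : ℕ → ℝ),
    0 ≤ (∑ d ∈ (∏ p ∈ S, p ^ n).divisors, ∑ d' ∈ (∏ p ∈ S, p ^ n).divisors,
      Complex.exp (I * ((∑ p ∈ S, θ p * (d.factorization p : ℝ) : ℝ) : ℂ)) *
        conj (Complex.exp (I * ((∑ p ∈ S, θ p * (d'.factorization p : ℝ) : ℝ) : ℂ))) *
        weilFunctional (weilTranslate
          (weilConv (fun t : ℝ => (ε : ℂ)⁻¹ * ((expNegInvGlue (1 - (t / ε) ^ 2) : ℝ) : ℂ))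
            (weilReflect (fun t : ℝ => (ε : ℂ)⁻¹ * ((expNegInvGlue (1 - (t / ε) ^ 2) : ℝ) : ℂ))))
          (Real.log (d : ℝ) - Real.log (d' : ℝ)))).re

/-- T0: `stub_fejer`'s registered signature is the name (`Iff.rfl`); v8 reads
`theorem stub_fejer : Theorems.FejerDivisorPositivity := by sorry` (type = the NAME; docstring "≡ RH,
`fejerDivisorPositivity_iff_riemannHypothesis`; RH-equivalent crux, no stub-worker"). PROVED. -/
theorem T0_stub_by_name : StubFejer ↔
    (∀ ε : ℝ, 0 < ε → ∀ S : Finset ℕ, (∀ p ∈ S, p.Prime) → ∀ (n : ℕ) (θ : ℕ → ℝ), 0 ≤ face ε S n θ) :=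
  Iff.rfl

/-- T0: the crux in Bohr–Fejér coordinates (tree: `WeilCombBohrFejer.combShapePositivity_iff_fejer`, named
`Theorems.combShapePositivity_iff_fejerDivisorPositivity`). PROVED. -/
theorem crux_iff_stubFejer : CombShapePositivity ↔ StubFejer :=
  Summit.RiemannHypothesis.RiemannHypothesis.Theorems.WeilCombBohrFejer.combShapePositivity_iff_fejer

/-- T0': the v8 composition, kernel-checked here: window cells by ANY window theorem (`stub_window` of the
skeleton), the co-final rest BY NAME. PROVED. -/
theorem T0_composition (hF : StubFejer)
    (window : ∀ ε : ℝ, 0 < ε → ∀ (M : ℕ) (a : ℕ → ℂ), 2 * ε * ((M : ℝ) + 1) ≤ 1 →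
      0 ≤ (weilQuadratic (fun x : ℝ => ∑ m ∈ Finset.Icc 1 M,
        a m * ((ε : ℂ)⁻¹ * ((expNegInvGlue (1 - ((x - Real.log (m : ℝ)) / ε) ^ 2) : ℝ) : ℂ)))).re) :
    CombShapePositivity := by
  intro ε hε M a
  by_cases hw : 2 * ε * ((M : ℝ) + 1) ≤ 1
  · exact window ε hε M a hw
  · exact (crux_iff_stubFejer.mpr hF) ε hε M a

/-- T0'': the kernel fact behind the ruling (tree: `WeilCombFejerConvSquare.fejer_iff_riemannHypothesis`, named
`Theorems.fejerDivisorPositivity_iff_riemannHypothesis`). PROVED. -/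
theorem T0_stub_iff_riemannHypothesis : StubFejer ↔ RiemannHypothesis :=
  Summit.RiemannHypothesis.RiemannHypothesis.Theorems.WeilCombFejerConvSquare.fejer_iff_riemannHypothesis

/-! ## T1 — the comb symbol is the zero-side exponential series (shared base; k2-A1 = k3-H2c ⊇ k1-H3b) -/

/-- ★ T1 (S, register as `stub_symbolExpSum`): `w_ε(x) = B_{φ_ε}(x) = Σ_ρ m(ρ) P_{φ_ε}(ρ) e^{(ρ−½)x}`.
Route: `k = τ_x(φ_ε ⋆ φ̃_ε)` is a Weil test; `k̂(ρ) = e^{(ρ−½)x} P_{φ_ε}(ρ)` (`weilMellin_weilTranslate`,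
`weilMellin_weilQuadratic`); `hasWeilZeroSide_tsum` (summability `summable_expSum`) and
`explicit_formula_holds`, `tendsto_nhds_unique` — the proof of `combShapeDetection_zeroForm_eq_weilQuadratic`
with a translate. -/
theorem stub_symbolExpSum : ∀ ε : ℝ, 0 < ε → ∀ x : ℝ,
    weilFunctional (weilTranslate
      (weilConv (fun t : ℝ => (ε : ℂ)⁻¹ * ((expNegInvGlue (1 - (t / ε) ^ 2) : ℝ) : ℂ))
        (weilReflect (fun t : ℝ => (ε : ℂ)⁻¹ * ((expNegInvGlue (1 - (t / ε) ^ 2) : ℝ) : ℂ)))) x) =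
      Literature.NumberTheory.LFunctions.WeilConverse.expSum
        (fun t : ℝ => (ε : ℂ)⁻¹ * ((expNegInvGlue (1 - (t / ε) ^ 2) : ℝ) : ℂ)) x := by
  sorry

/-- T1 in the local notation. PROVED from `stub_symbolExpSum`. -/
theorem sym_eq_expSum {ε : ℝ} (hε : 0 < ε) (x : ℝ) : sym ε x = expSum (bump ε) x :=
  stub_symbolExpSum ε hε x

/-- T1': the symbol is continuous (k3-H2c'). PROVED from T1. -/
theorem continuous_sym {ε : ℝ} (hε : 0 < ε) : Continuous (sym ε) := by
  have e : sym ε = expSum (bump ε) := funext (sym_eq_expSum hε)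
  rw [e]
  exact Summit.RiemannHypothesis.RiemannHypothesis.Theorems.combShapeDetection_continuous_expSum
    (Summit.RiemannHypothesis.RiemannHypothesis.Theorems.combShapeDetection_shapeBump_isWeilTest ε)

/-! ## T2 — DILATION DETECTION: the `S = ∅` face (one real parameter) is already RH (k1-H3…H8, repaired) -/

/-- T2a (S): the real EVEN bump turns the pairing into a SQUARE: `P_{φ_ε}(ρ) = φ̂_ε(ρ)²`
(`conj φ̂(1 − ρ̄) = ∫ φ(u) e^{−(ρ−½)u} du = φ̂(ρ)` by `u ↦ −u`). The whole RH content: not `|·|²`. -/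
theorem pairCoeff_bump_eq_sq (ε : ℝ) (ρ : ℂ) : pairCoeff (bump ε) ρ = weilMellin (bump ε) ρ ^ 2 := by
  sorry

/-- T2b (S): dilation `φ̂_ε(s) = Φ₀(ε(s − ½))`, `Φ₀(z) = φ̂_1(½ + z)` (`weilMellin_comp_mul`). -/
theorem weilMellin_bump {ε : ℝ} (hε : 0 < ε) (s : ℂ) :
    weilMellin (bump ε) s = weilMellin (bump 1) (1 / 2 + ε * (s - 1 / 2)) := by
  sorry

/-- T2c (S): zero side of the diagonal `W(ψ_ε) = Σ_ρ m(ρ) Φ₀(ε(ρ−½))²`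
(`combShapeDetection_zeroForm_eq_weilQuadratic` + T2a + T2b). -/
theorem diag_eq_tsum_sq {ε : ℝ} (hε : 0 < ε) :
    diag ε = ∑' ρ : ZetaZeros.riemannZetaNontrivialZeros,
      (riemannZetaZeroOrder (ρ : ℂ) : ℂ) * weilMellin (bump 1) (1 / 2 + ε * ((ρ : ℂ) - 1 / 2)) ^ 2 := by
  sorry

/-- T2d (S): two integrations by parts: `|Φ₀(z)| ≤ C e^{|Re z|}/(1 + |z|²)` — shared by T2e and T2h. -/
theorem norm_weilMellin_bump_one_le : ∃ C : ℝ, ∀ z : ℂ,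
    ‖weilMellin (bump 1) (1 / 2 + z)‖ ≤ C * Real.exp |z.re| / (1 + ‖z‖ ^ 2) := by
  sorry

/-- T2e (S): growth `‖W(ψ_ε)‖ ≤ C e^{ε}` for `ε ≥ 1` (T2c, T2d, `|Re ρ − ½| < ½`, `Σ_ρ |Im ρ|⁻⁴ < ∞`) and
continuity in `ε` (dominated convergence in T2c, or `hasDerivAt_weilFunctional_comp_mul`): the Laplace
integrand of T2 is measurable and absolutely convergent on `Re s > 1`. -/
theorem norm_diag_le : ∃ C : ℝ, ∀ ε : ℝ, 1 ≤ ε → ‖diag ε‖ ≤ C * Real.exp ε := by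
  sorry

theorem continuousOn_diag : ContinuousOn diag (Ioi 0) := by
  sorry

/-- `ψ₀ = φ₀ ⋆ φ₀` (smooth, even, `> 0` exactly on `(−2, 2)`, `= 0` outside). -/
def bumpK (t : ℝ) : ℝ := ∫ u : ℝ, expNegInvGlue (1 - u ^ 2) * expNegInvGlue (1 - (t - u) ^ 2)

/-- the one-zero kernel `T_w(s) = ∫_{-2}^{2} ψ₀(t) e^{ε₀(wt − s)}/(s − wt) dt` (continuation of the Laplace
transform in the dilation variable of `Φ₀(εw)²` to `ℂ ∖ w·[−2,2]`). -/
def cauchyT (ε₀ : ℝ) (w s : ℂ) : ℂ :=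
  ∫ t in (-2 : ℝ)..2, (bumpK t : ℂ) * cexp ((ε₀ : ℂ) * (w * t - s)) / (s - w * t)

/-- T2f (S): `ψ₀ > 0` on `(−2, 2)`. -/
theorem bumpK_pos {t : ℝ} (ht : t ∈ Ioo (-2 : ℝ) 2) : 0 < bumpK t := by
  sorry

/-- T2g (S): `Φ₀(z)² = ∫_{-2}^{2} ψ₀(t) e^{zt} dt` (transform of `φ₀ ⋆ φ₀`; `weilMellin_weilConv_holds`). -/
theorem sq_weilMellin_eq_integral_bumpK (z : ℂ) :
    weilMellin (bump 1) (1 / 2 + z) ^ 2 = ∫ t in (-2 : ℝ)..2, (bumpK t : ℂ) * cexp (z * t) := by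
  sorry

/-- T2h (M): `∫_{ε₀}^∞ Φ₀(εw)² e^{−sε} dε = T_w(s)` for `Re s > 2|Re w|` (T2g + Fubini on `[−2,2] × (ε₀,∞)`,
`∫_{ε₀}^∞ e^{ε(wt − s)} dε = e^{ε₀(wt−s)}/(s − wt)`). -/
theorem laplace_sq_eq_cauchyT {ε₀ : ℝ} (hε₀ : 0 < ε₀) (w s : ℂ) (hs : 2 * |w.re| < s.re) :
    ∫ ε in Ioi ε₀, weilMellin (bump 1) (1 / 2 + ε * w) ^ 2 * cexp (-(s * ε)) = cauchyT ε₀ w s := by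
  sorry

/-- T2i (M): `T_w` is holomorphic off the closed segment `w·[−2, 2]` (differentiation under `∫`). -/
theorem differentiableOn_cauchyT (ε₀ : ℝ) (w : ℂ) :
    DifferentiableOn ℂ (cauchyT ε₀ w) {s : ℂ | ∀ t : ℝ, t ∈ Icc (-2 : ℝ) 2 → s ≠ w * t} := by
  sorry

/-- T2j (M): FAVOURABLE-SIDE bound. If `Im(s/w) < 0` (equivalently `Im(s conj w)·… < 0` as below) then
`1/(s − wt) = (i/w)∫₀^∞ e^{iη(t − s/w)} dη`, so `T_w(s) = (i/w) e^{−ε₀ s} ∫₀^∞ e^{−iηs/w} Φ₀(ε₀w + iη)² dη` and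
T2d gives `‖T_w(s)‖ ≤ C/|Im w|³`, uniformly for `0 ≤ Re s`, `‖s‖ ≤ R`. Every zero is favourable on the cone
`|Im s| < κ Re s`, `κ < inf |γ_ρ/(Re ρ − ½)|`; ON-LINE zeros (`Re w = 0`) need no kernel at all: their Laplace
integral converges absolutely for `Re s ≥ 0` with the bound `C/(|γ|(ε₀|γ|)³)`. -/
theorem norm_cauchyT_le {ε₀ : ℝ} (hε₀ : 0 < ε₀) (R : ℝ) :
    ∃ C : ℝ, ∀ w s : ℂ, |w.re| ≤ 1 / 2 → 1 ≤ |w.im| → 0 ≤ s.re → ‖s‖ ≤ R →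
      (s * conj w).im * w.im < 0 → ‖cauchyT ε₀ w s‖ ≤ C / |w.im| ^ 3 := by
  sorry

/-- T2k (M): the continuation `G(s) = Σ_ρ m(ρ) T_{ρ−½}(s)` is holomorphic on the right half-plane minus the
segments of the OFF-LINE zeros (locally: all but finitely many zeros are favourable on a compact
`K ⊂ {Re s > 0}` — unfavourable needs `|γ| ≤ R_K |a|/σ_K ≤ R_K/(2σ_K)` — so `differentiableOn_tsum_of_summable_norm`
applies to the tail and T2i to the finitely many others). -/
theorem differentiableOn_zeroSum_cauchyT {ε₀ : ℝ} (hε₀ : 0 < ε₀) :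
    DifferentiableOn ℂ
      (fun s : ℂ => ∑' ρ : ZetaZeros.riemannZetaNontrivialZeros,
        (riemannZetaZeroOrder (ρ : ℂ) : ℂ) * cauchyT ε₀ ((ρ : ℂ) - 1 / 2) s)
      {s : ℂ | 0 < s.re ∧ ∀ ρ : ℂ, ρ ∈ ZetaZeros.riemannZetaNontrivialZeros → ρ.re ≠ 1 / 2 →
        ∀ t : ℝ, t ∈ Icc (-2 : ℝ) 2 → s ≠ (ρ - 1 / 2) * t} := by
  sorry

/-- T2l (M) — the JUMP across the cut (replaces k1-H6's circle integral through the cut, whose Fubini is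
log-singular): approaching an interior point `w t₀` of the segment along the unit normal `n = i w/|w|`,
`T_w(wt₀ + ηn) − T_w(wt₀ − ηn) → −2πi ψ₀(t₀)/w ≠ 0` (`1/(w(u+iδ)) − 1/(w(u−iδ)) = −2iδ/(w(u²+δ²))`,
`δ = η/|w|`: a Poisson kernel against the continuous density `ψ₀(t) e^{ε₀ w (t−t₀)}`). For zeros on the
same line (`w_j = λ_j w`, `λ_j > 0` after `T_{−w} = T_w`) the jumps at `w t₀` add with one sign:
`−(2πi/w) Σ_j (m_j/λ_j) ψ₀(t₀/λ_j)`. -/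
theorem cauchyT_jump {ε₀ : ℝ} (hε₀ : 0 < ε₀) {w : ℂ} (hw : w ≠ 0) {t₀ : ℝ} (ht₀ : t₀ ∈ Ioo (-2 : ℝ) 2) :
    Tendsto (fun η : ℝ => cauchyT ε₀ w (w * t₀ + η * (I * w / (‖w‖ : ℂ))) -
        cauchyT ε₀ w (w * t₀ - η * (I * w / (‖w‖ : ℂ))))
      (𝓝[>] 0) (𝓝 (-(2 * π * I / w) * (bumpK t₀ : ℂ))) := by
  sorry

theorem cauchyT_neg (ε₀ : ℝ) (w s : ℂ) : cauchyT ε₀ (-w) s = cauchyT ε₀ w s := by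
  sorry

/-- ★ T2 (L; register as `stub_dilationDetection`) — **DILATION DETECTION**: nonnegativity of the single
diagonal entry `W(φ_ε ⋆ φ̃_ε)` for all widths `ε ≥ 1` implies RH. Proof (template:
`Turan1948.riemannHypothesis_of_nonneg`): `g(x) = Re W(ψ_{log x})·1_{x > e}`, `F = Landau.mellinIoi g`
converges absolutely on `Re s > 2` (T2e) and equals `G` there (T2c, T2h, dominated interchange); `G` is
holomorphic on `{Re s > 2} ∪ W₀`, `W₀ = {0 < Re s < 4, |Im s| < κ Re s}` convex (T2k: no segment meets the
cone or `Re s > 1`); Landau (`Landau.integrableOn_of_differentiableOn_union_convex`, `a = 0`) ⇒ `F`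
holomorphic on `Re s > 0`. If some zero is off the line, take the off-line zero line of least positive
angle, `s₀ = w₀ t₀` (`t₀ ∈ (0,2)` generic), the two adjacent open SECTORS (convex, segment-free, unbounded ⇒
meet `Re s > 2`): `F = G` on both (identity theorem); `F` and the other-zeros part of `G` are continuous at
`s₀`, so the same-line part has zero jump at `s₀` — contradicting T2l. -/
theorem stub_dilationDetection :
    (∀ ε : ℝ, 1 ≤ ε → 0 ≤ (weilQuadratic
      (fun t : ℝ => (ε : ℂ)⁻¹ * ((expNegInvGlue (1 - (t / ε) ^ 2) : ℝ) : ℂ))).re) →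
    RiemannHypothesis := by
  sorry

/-- the `S = ∅` cell of the stub is `diag ε` (k1-H2). PROVED. -/
theorem face_empty (ε : ℝ) (n : ℕ) (θ : ℕ → ℝ) :
    (∑ d ∈ (∏ p ∈ (∅ : Finset ℕ), p ^ n).divisors, ∑ d' ∈ (∏ p ∈ (∅ : Finset ℕ), p ^ n).divisors,
        Complex.exp (I * ((∑ p ∈ (∅ : Finset ℕ), θ p * (d.factorization p : ℝ) : ℝ) : ℂ)) *
          conj (Complex.exp (I * ((∑ p ∈ (∅ : Finset ℕ), θ p * (d'.factorization p : ℝ) : ℝ) : ℂ))) *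
          weilFunctional (weilTranslate
            (weilConv (fun t : ℝ => (ε : ℂ)⁻¹ * ((expNegInvGlue (1 - (t / ε) ^ 2) : ℝ) : ℂ))
              (weilReflect (fun t : ℝ => (ε : ℂ)⁻¹ * ((expNegInvGlue (1 - (t / ε) ^ 2) : ℝ) : ℂ))))
            (Real.log (d : ℝ) - Real.log (d' : ℝ)))) = diag ε := by
  have hb : bump ε = fun t : ℝ => (ε : ℂ)⁻¹ * ((expNegInvGlue (1 - (t / ε) ^ 2) : ℝ) : ℂ) := rfl
  rw [diag_eq_sym_zero]
  unfold sym
  simp [hb]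

/-- T2 ⇒ **the minimal face**: `RH ⟺ ∀ ε > 0, 0 ≤ Re W(φ_ε ⋆ φ̃_ε)` — the stub (all `S, n, θ`) is equivalent
to its `S = ∅` face, the crux to its `M = 1` cells (corrects Disproof §9 / the route text: the `M = 1` rung
is RH-complete, not "one harmless explicit function of ε"). PROVED from `stub_dilationDetection`. -/
theorem diag_nonneg_iff_riemannHypothesis :
    (∀ ε : ℝ, 0 < ε → 0 ≤ (diag ε).re) ↔ RiemannHypothesis := by
  refine ⟨fun h => stub_dilationDetection fun ε hε => h ε (by linarith), fun hRH ε hε => ?_⟩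
  have h := Summit.RiemannHypothesis.RiemannHypothesis.Theorems.WeilCombBohrFejer.fejer_of_riemannHypothesis
    hRH ε hε ∅ (by simp) 0 (fun _ => 0)
  rwa [face_empty] at h

/-- Corollary of T2 (one line): RH ⟺ the Fejér faces on ANY fixed torus `T^S` for all `ε` (the `n = 0`
face of every `S` is `diag ε`) — in particular k3-H2e / k2-Plan-B (`S = {2,3}`) without density or
detection. PROVED from `stub_dilationDetection`. -/
theorem riemannHypothesis_iff_face_fixed_torus (S : Finset ℕ) (hS : ∀ p ∈ S, p.Prime) :
    RiemannHypothesis ↔ ∀ ε : ℝ, 0 < ε → ∀ (n : ℕ) (θ : ℕ → ℝ), 0 ≤ face ε S n θ := by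
  constructor
  · intro hRH ε hε n θ
    exact Summit.RiemannHypothesis.RiemannHypothesis.Theorems.WeilCombBohrFejer.fejer_of_riemannHypothesis
      hRH ε hε S hS n θ
  · intro h
    refine diag_nonneg_iff_riemannHypothesis.mp fun ε hε => ?_
    have h0 := h ε hε 0 (fun _ => 0)
    simpa [face, chi, diag_eq_sym_zero] using h0

/-! ## T3 — TWO-PRIME COLLAPSE at FIXED `ε` (k3-H2; unconditional structure, no zeros, no `∀ ε`) -/

/-- T3a (M): S-LOCAL, EVENTUAL-in-`n` product-vector reduction for an ARBITRARY kernel `w` — a copy of the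
proof of `WeilCombBohrFejer.stub_reduction` (which instantiates `S :=` primes `≤ M`, nodes `Icc 1 M`) with
the given `S` and an arbitrary finite node set `T` of `S`-smooth integers; it uses only levels `n + n₁`,
`n → ∞`, so an eventual hypothesis suffices (this also yields T5a). -/
theorem reduction_local (w : ℝ → ℂ) (S : Finset ℕ) (hS : ∀ p ∈ S, p.Prime) (n₀ : ℕ)
    (hbox : ∀ n : ℕ, n₀ ≤ n → ∀ θ : ℕ → ℝ,
      0 ≤ (∑ d ∈ (∏ p ∈ S, p ^ n).divisors, ∑ d' ∈ (∏ p ∈ S, p ^ n).divisors,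
        chi S θ d * conj (chi S θ d') * w (Real.log (d : ℝ) - Real.log (d' : ℝ))).re)
    (T : Finset ℕ) (hT : ∀ m ∈ T, m ≠ 0 ∧ m.primeFactors ⊆ S) (c : ℕ → ℂ) :
    0 ≤ (∑ m ∈ T, ∑ m' ∈ T, c m * conj (c m') * w (Real.log (m : ℝ) - Real.log (m' : ℝ))).re := by
  sorry

/-- T3b (S): `ℤ log p + ℤ log q` is dense for distinct primes (`AddSubgroup.dense_or_cyclic`; cyclic would
force `p^l = q^k`, `Nat.Prime.pow_inj`). -/
theorem dense_two_logs {p q : ℕ} (hp : p.Prime) (hq : q.Prime) (hpq : p ≠ q) :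
    Dense ((AddSubgroup.closure ({Real.log (p : ℝ), Real.log (q : ℝ)} : Set ℝ) : AddSubgroup ℝ) : Set ℝ) := by
  sorry

/-- T3c (S): PSD of the node forms of a CONTINUOUS kernel passes from nodes in a dense additive subgroup to
arbitrary real nodes (closed superlevel set; `dense_pi`). -/
theorem psd_of_dense {w : ℝ → ℂ} (hw : Continuous w) {G : AddSubgroup ℝ} (hG : Dense (G : Set ℝ))
    (hpos : ∀ (k : ℕ) (x : Fin k → ℝ) (c : Fin k → ℂ), (∀ i, x i ∈ G) →
      0 ≤ (∑ i, ∑ j, c i * conj (c j) * w (x i - x j)).re)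
    {ι : Type*} (T : Finset ι) (x : ι → ℝ) (c : ι → ℂ) :
    0 ≤ (∑ i ∈ T, ∑ j ∈ T, c i * conj (c j) * w (x i - x j)).re := by
  sorry

/-- ★ T3 (M; register as `stub_twoPrimeCollapse`): at FIXED `ε`, the Fejér family on ONE torus of dimension
`≥ 2` already gives every crux cell at that `ε`: T3a (`w = sym ε`, nodes `p^{i+A} q^{j+B}`: a common shift
makes lattice nodes integral, differences unchanged) ⇒ PSD on `ℤ log p + ℤ log q` ⇒ (T3b, T1', T3c) PSD at
nodes `log 1, …, log M` ⇒ Gram identity `stub_gram` ⇒ the cell. Induction on `|S|` therefore has exactly one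
contentful step, `1 → 2`, and it is the crux. -/
theorem stub_twoPrimeCollapse : ∀ ε : ℝ, 0 < ε → ∀ S : Finset ℕ, (∀ p ∈ S, p.Prime) → 1 < S.card →
    (∀ (n : ℕ) (θ : ℕ → ℝ),
      0 ≤ (∑ d ∈ (∏ p ∈ S, p ^ n).divisors, ∑ d' ∈ (∏ p ∈ S, p ^ n).divisors,
        Complex.exp (I * ((∑ p ∈ S, θ p * (d.factorization p : ℝ) : ℝ) : ℂ)) *
          conj (Complex.exp (I * ((∑ p ∈ S, θ p * (d'.factorization p : ℝ) : ℝ) : ℂ))) *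
          weilFunctional (weilTranslate
            (weilConv (fun t : ℝ => (ε : ℂ)⁻¹ * ((expNegInvGlue (1 - (t / ε) ^ 2) : ℝ) : ℂ))
              (weilReflect (fun t : ℝ => (ε : ℂ)⁻¹ * ((expNegInvGlue (1 - (t / ε) ^ 2) : ℝ) : ℂ))))
            (Real.log (d : ℝ) - Real.log (d' : ℝ)))).re) →
    ∀ (M : ℕ) (a : ℕ → ℂ), 0 ≤ (weilQuadratic (fun x : ℝ => ∑ m ∈ Finset.Icc 1 M,
      a m * ((ε : ℂ)⁻¹ * ((expNegInvGlue (1 - ((x - Real.log (m : ℝ)) / ε) ^ 2) : ℝ) : ℂ)))).re := by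
  sorry

/-- T3 corollary at `S = {2, 3}` (k3-H2e with the fixed-`ε` information kept): for each `ε`,
stub_fejer(ε) ⟺ face on `T²_{2,3}` at `ε` ⟺ crux(ε). PROVED from `stub_twoPrimeCollapse`. -/
theorem cruxAt_of_face_two_three {ε : ℝ} (hε : 0 < ε)
    (h : ∀ (n : ℕ) (θ : ℕ → ℝ), 0 ≤ face ε {2, 3} n θ) (M : ℕ) (a : ℕ → ℂ) :
    0 ≤ (weilQuadratic (fun x : ℝ => ∑ m ∈ Finset.Icc 1 M,
      a m * ((ε : ℂ)⁻¹ * ((expNegInvGlue (1 - ((x - Real.log (m : ℝ)) / ε) ^ 2) : ℝ) : ℂ)))).re :=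
  stub_twoPrimeCollapse ε hε {2, 3}
    (fun p hp => by
      simp only [Finset.mem_insert, Finset.mem_singleton] at hp
      rcases hp with rfl | rfl <;> norm_num)
    (by decide) h M a

/-! ## T4 — the ZERO-SIDE PRODUCT FORMULA (explicit formula in Bohr coordinates; k2-A4 = k3-H4): the
identity on which every SOS / majorant / Fejér–Riesz proposal is measured -/

/-- ★ T4 (M; register as `stub_fejerZeroProduct`): with `u_p = exp(iθ_p + (ρ−½) log p)`,
`Σ_{d,d'∣N} χ_θ(d) conj χ_θ(d') w_ε(log d/d') = Σ_ρ m(ρ) P_{φ_ε}(ρ) ∏_{p∈S} (Σ_{j≤n} u_p^j)(Σ_{k≤n} u_p^{−k})`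
(T1 termwise, `Summable.tsum_finsetSum`, box factorisation `WeilCombFejerBoxIdentity.factorization_primeBox`).
Under RH `|u_p| = 1` and each term is `m |φ̂_ε(ρ)|² ∏_p |D_n(θ_p + γ log p)|² ≥ 0` (transparent RH ⇒ C⁺);
off the line a term grows like `p^{n(β−½)}` against on-line mass `O((n+1)^{|S|} w_ε(0))`. -/
theorem stub_fejerZeroProduct : ∀ ε : ℝ, 0 < ε → ∀ S : Finset ℕ, (∀ p ∈ S, p.Prime) →
    ∀ (n : ℕ) (θ : ℕ → ℝ),
      (∑ d ∈ (∏ p ∈ S, p ^ n).divisors, ∑ d' ∈ (∏ p ∈ S, p ^ n).divisors,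
        Complex.exp (I * ((∑ p ∈ S, θ p * (d.factorization p : ℝ) : ℝ) : ℂ)) *
          conj (Complex.exp (I * ((∑ p ∈ S, θ p * (d'.factorization p : ℝ) : ℝ) : ℂ))) *
          weilFunctional (weilTranslate
            (weilConv (fun t : ℝ => (ε : ℂ)⁻¹ * ((expNegInvGlue (1 - (t / ε) ^ 2) : ℝ) : ℂ))
              (weilReflect (fun t : ℝ => (ε : ℂ)⁻¹ * ((expNegInvGlue (1 - (t / ε) ^ 2) : ℝ) : ℂ))))
            (Real.log (d : ℝ) - Real.log (d' : ℝ)))) =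
      ∑' ρ : ZetaZeros.riemannZetaNontrivialZeros,
        (riemannZetaZeroOrder (ρ : ℂ) : ℂ) *
          Literature.NumberTheory.LFunctions.WeilConverse.pairCoeff
            (fun t : ℝ => (ε : ℂ)⁻¹ * ((expNegInvGlue (1 - (t / ε) ^ 2) : ℝ) : ℂ)) (ρ : ℂ) *
          ∏ p ∈ S,
            ((∑ j ∈ Finset.range (n + 1),
                Complex.exp (I * (θ p : ℂ) + ((ρ : ℂ) - 1 / 2) * (Real.log (p : ℝ) : ℂ)) ^ j) *
              (∑ k ∈ Finset.range (n + 1),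
                (Complex.exp (I * (θ p : ℂ) + ((ρ : ℂ) - 1 / 2) * (Real.log (p : ℝ) : ℂ)))⁻¹ ^ k)) := by
  sorry

/-- T4' (S): on the critical line each term of T4 is a nonnegative real
(`weilMellin_weilQuadratic_of_re_eq`; `(Σ u^j)(Σ u^{-k}) = |Σ u^j|²` for `|u| = 1`). -/
theorem zeroProduct_term_nonneg {ε : ℝ} (hε : 0 < ε) (S : Finset ℕ) (hS : ∀ p ∈ S, p.Prime) (n : ℕ)
    (θ : ℕ → ℝ) {ρ : ℂ} (hρ : ρ ∈ ZetaZeros.riemannZetaNontrivialZeros) (hre : ρ.re = 1 / 2) :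
    0 ≤ ((riemannZetaZeroOrder ρ : ℂ) * pairCoeff (bump ε) ρ *
        ∏ p ∈ S, ((∑ j ∈ Finset.range (n + 1),
            Complex.exp (I * (θ p : ℂ) + (ρ - 1 / 2) * (Real.log (p : ℝ) : ℂ)) ^ j) *
          (∑ k ∈ Finset.range (n + 1),
            (Complex.exp (I * (θ p : ℂ) + (ρ - 1 / 2) * (Real.log (p : ℝ) : ℂ)))⁻¹ ^ k))).re ∧
      ((riemannZetaZeroOrder ρ : ℂ) * pairCoeff (bump ε) ρ *
        ∏ p ∈ S, ((∑ j ∈ Finset.range (n + 1),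
            Complex.exp (I * (θ p : ℂ) + (ρ - 1 / 2) * (Real.log (p : ℝ) : ℂ)) ^ j) *
          (∑ k ∈ Finset.range (n + 1),
            (Complex.exp (I * (θ p : ℂ) + (ρ - 1 / 2) * (Real.log (p : ℝ) : ℂ)))⁻¹ ^ k))).im = 0 := by
  sorry

/-! ## T5 — census corollaries (optional; each ≤ 1 cycle given T1/T3a) -/

/-- T5a (S given T3a): every family of boxes co-final in `n` (at each `ε`, `S`) is the whole stub (the `n`-analogue
of `combShapePositivity_iff_cofinal`): "induction on `n`" / "perturb off the window" has no sub-RH rung. -/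
theorem stub_iff_eventually_n (n₀ : ℝ → Finset ℕ → ℕ) :
    StubFejer ↔
      ∀ ε : ℝ, 0 < ε → ∀ S : Finset ℕ, (∀ p ∈ S, p.Prime) →
        ∀ n : ℕ, n₀ ε S ≤ n → ∀ θ : ℕ → ℝ, 0 ≤ face ε S n θ := by
  sorry

/-- T5b (PROVED, k3-H1): the window face is a theorem now — `ε·∏p^n ≤ 1/128 ⇒ face ≥ 0`
(`fejer_of_cell` + `stub_windowSub`; `1/25` with the banked `combShapePositivity_of_mul_le_inv_25`). -/
theorem face_window : ∀ ε : ℝ, 0 < ε → ∀ S : Finset ℕ, (∀ p ∈ S, p.Prime) → ∀ (n : ℕ) (θ : ℕ → ℝ),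
    ε * ((∏ p ∈ S, p ^ n : ℕ) : ℝ) ≤ 1 / 128 → 0 ≤ face ε S n θ := by
  intro ε hε S hS n θ h
  exact Summit.RiemannHypothesis.RiemannHypothesis.Theorems.WeilCombBohrFejer.fejer_of_cell hε hS n θ
    (fun a => Summit.RiemannHypothesis.RiemannHypothesis.Theorems.WeilCombBohrFejer.stub_windowSub ε hε _ a h)

/-- T5c (M, k3-H3): faces are downward hereditary in `S` (average out one angle over `L`-th roots of unity):
the failing set is an up-set. -/
theorem face_erase : ∀ ε : ℝ, 0 < ε → ∀ S : Finset ℕ, (∀ p ∈ S, p.Prime) → ∀ q ∈ S,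
    ∀ (n : ℕ) (θ : ℕ → ℝ), (∀ t : ℝ, 0 ≤ face ε S n (Function.update θ q t)) →
      0 ≤ face ε (S.erase q) n θ := by
  sorry

/-- T5d (S/M, k2-B2): lattice minors from eventual Fejér positivity at fixed `(ε, S)`: a Fourier coefficient
of a nonnegative trigonometric polynomial is bounded by its mean, `∏_p(1 − |h_p|/(n+1))·|w_ε(⟨h,log p⟩)| ≤ w_ε(0)`,
`n → ∞` (necessary conditions usable by the disprover at every `S`-unit lag). -/
theorem norm_sym_le_of_eventually {ε : ℝ} (hε : 0 < ε) {S : Finset ℕ} (hS : ∀ p ∈ S, p.Prime)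
    (hF : ∀ᶠ n in atTop, ∀ θ : ℕ → ℝ, 0 ≤ face ε S n θ) {d d' : ℕ} (hd : d ≠ 0) (hd' : d' ≠ 0)
    (hdS : d.primeFactors ⊆ S) (hd'S : d'.primeFactors ⊆ S) :
    ‖sym ε (Real.log (d : ℝ) - Real.log (d' : ℝ))‖ ≤ (sym ε 0).re := by
  sorry

/-- T5e (M, k2-D1): the de-arithmetised (Bochner) form — the stub says `w_ε` is of positive type on `ℝ`
(`⇐` nodes `log d`; `⇒` T3 + T3b/T1'/T3c at arbitrary real nodes). -/
theorem stub_iff_posDef :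
    StubFejer ↔
      ∀ ε : ℝ, 0 < ε → ∀ (k : ℕ) (x : Fin k → ℝ) (c : Fin k → ℂ),
        0 ≤ (∑ i, ∑ j, c i * conj (c j) * sym ε (x i - x j)).re := by
  sorry

end Summit.RiemannHypothesis.RiemannHypothesis.Cruxes.CombShapePositivity.StubPlanFejer

end
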